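/-
Origin: expansion seat `planner-pub-hodgecm-pv08-0`, handover 2026-08-18T03:34:24Z (`HOME/pub-hodgecm-pv08/lean/Pv08/S12Wedges.lean`, md5 1f2e0b9d, 220 lines);
landed by the gen-5 packager in gate run 19 as `HodgeCM/PerL34/S12Wedges.lean` (verbatim).
-/
/-
Origin: HOME/pub-hodgecm-pv08/lean/Pv08/S12Wedges.lean — session planner-pub-hodgecm-pv08-0 (unit pub-hodgecm-pv08,
DAG-NODE PROVER #08).  Intended final place: `HodgeCM/PerL34/S12Wedges.lean` (the carver's stub name for node N19,
HOME/LEMMAS.md §1 row N19).  DAG node: **N19** = PerL v5 Lemma 3.5 (`lem:S12`) first assertion, tex ll. 350–353,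
proof ll. 355–375, BOTH inclusions, for both torus sides.  No input is minted: the theorems below are (a) the
kernel-checked EQUIVALENCE of PerL's lemma "S = closure of the span of the wedges" with the conjunction of the two
inclusion statements the package posits separately (model inputs A7 / A8, `ThetaRealisation.gen12` / `real34`), and
(b) honest splits of each inclusion into its print-heart residue (seesaw identity; Fock-polynomial finite-sum
computation on a dense subspace) plus passages that ARE proved here (allowedness bookkeeping; density + continuity,
pure Mathlib topology over the interface's own continuity field AX5b).
-/
import Summits.HodgeConjecture.HodgeCM.Automorphic.ThetaFacts

set_option autoImplicit false

/-!
# PerL v5 Lemma 3.5 (i) (DAG node N19): `S₁₂` is the closed span of the wedges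

Verbatim (tex ll. 350–353):

> `S_{12}` is the closure of the span of the wedges `u_1\wedge u_2` (viewed as scalar functions, \S\ref{ss:forms})
> with `u_j` holomorphic `1`-forms attached to vectors of `\pi_j[\fp_+]`, `\pi_j=\Theta^{W_j}_{\mu_j}(\chi'_j)` the theta
> spaces of allowed pairs of type `(12)`; similarly for `S_{34}`.

Proof structure in PerL (ll. 355–375): (gen ⊆) "`\mathrm{pr}_\kappa(\mathcal P)` is dense in `\cS^\kappa`. By
continuity of `\vartheta_{T,\chi_{12}}` it suffices to treat `\Phi\in\mathrm{pr}_\kappa(\mathcal P)`" (ll. 356–359),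
and for those `Φ` the seesaw identity (eq:seesaw) and the `K`-type count in the Fock model give "every `K`-finite
generator of `S_{12}` is a linear combination of wedges `u_1\wedge u_2` of such forms" (ll. 360–372); (wedge ⊆) "and
conversely every such wedge is a generator (… `u_1\wedge u_2=\vartheta_{T,\chi_{12}}(\Phi')=\ldots=\vartheta_{T,\chi_{12}}
(\mathrm{pr}_\kappa\Phi')` for `\Phi'=\phi^1_1\otimes\phi^2_2-\phi^2_1\otimes\phi^1_2`…)" (ll. 372–375).

## Typing over the theta model

For `T : U.ThetaModel`, a Hermitian space `V` over `(L, ι₁)` and a seesaw context `c`, a TORUS SIDE is a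
`D : Perl34.TorusData (T.core V c)` together with the pair of type indices `(k, l)` its theta one-forms carry:
`(T.t12 V c, 0, 1)` for `(T, w, S₁₂)` and `(T.t34 V c, 2, 3)` for `(T', w', S₃₄)` ("similarly for `S_{34}`").  The
wedges "viewed as scalar functions" over all levels are `T.wedgeSet V c k l` (ThetaModel.lean), `S` is `D.S12`
(pinned by `D.S12_def` to the closed span of the `ϑ_{T,χ}(Φ)`, `χ` allowed — ll. 348–349), so the lemma reads
`D.S12 = (span (wedgeSet k l)).topologicalClosure` (`N19_statement`).

Rendering notes (not divergences): (R-a) as in node N33d, the model's `Theta` sets index the `u_f` by type only, so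
"forms attached to vectors of `π_j[𝔭₊]`, `π_j` theta spaces of ALLOWED pairs" becomes "theta one-forms of type
`Ψ_k`", and the allowedness of every pair of such characters for the FIXED lines (Prop 4.3 proof ll. 660–662 =
node N31's output) enters the (wedge ⊆) direction explicitly (`N19_charsIn`); (R-b) the Fock-polynomial subspace
`pr_κ(𝒫) ⊂ 𝒮^κ` has no name in the model (no Weil-representation vocabulary, LEMMAS.md §3 D4/D5), so the finite-sum
core of (gen ⊆) is typed with the dense subspace EXISTENTIALLY quantified (`N19g_core`).

## What is proved here (kernel-checked)

* `N19_iff` — PerL's Lemma 3.5 (i) for a side ⟺ (wedge ⊆) ∧ (gen ⊆, closure form); i.e. the package's two posited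
  inclusions (A7-shape `N19_wedgeIn`, A8-shape `N19_genIn`) are together EXACTLY the lemma, neither weaker nor stronger.
* `N19w_of`, `N19w_of_allowedIdentity` — (wedge ⊆) ⇐ the seesaw-generator identity (ll. 372–375, residual INPUT
  `N19w_genIdentity`, = node N17 + "`pr_κ` commutes with `ϑ`") + allowedness (node N31) — PROVED join.
* `N19g_of` — (gen ⊆, closure form) ⇐ the finite-sum core on a dense subspace (ll. 356–372, residual INPUT
  `N19g_core`) — the density/continuity passage "by continuity of `\vartheta_{T,\chi_{12}}` it suffices to treat
  `\Phi\in\mathrm{pr}_\kappa(\mathcal P)`" PROVED from the interface's continuity field `AX5b_ϑ_cont` (node N18) and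
  the bounded inclusion `C([G_U]) ⊂ L²` (`IsolationCore.inclCG`), via `image_closure_subset_closure_image`.
* `N19_of_cores` — the whole lemma for a side from the two residual cores + allowedness.
-/

namespace HodgeCM
namespace PerL34

open HodgeCM.Prior.Perl34File

variable {U : Universe} (T : U.ThetaModel)
variable {L : CMField} {ι₁ : L →+* ℂ} (V : HermSpace3 L ι₁) (c : SeesawCtx L)
variable (D : Perl34.TorusData (T.core V c)) (k l : Fin 4)

/-! ### The two inclusions and the lemma -/

/-- **(wedge ⊆ S)** (PerL v5 Lemma 3.5 proof, ll. 372–375: "conversely every such wedge is a generator"), for the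
side `(D, k, l)`: the `L²` function of the wedge of theta one-forms of types `Ψ_k, Ψ_l` at any level lies in `S`.
For `(T.t12 V c, 0, 1)` this is the body of model input A7 / the `gen12` field of `Universe.ThetaRealisation`. -/
def N19_wedgeIn : Prop :=
  ∀ (Γ : Level V) (ω ω' : U.CohC (U.pms L ι₁ V Γ) 1), ω ∈ T.Theta V c k Γ → ω' ∈ T.Theta V c l Γ →
    T.Λ Γ ω ω' ∈ D.S12

/-- **(gen ⊆ closed wedge span)** (PerL v5 Lemma 3.5 proof, ll. 356–372: "every `K`-finite generator of `S_{12}`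
is a linear combination of wedges", then density + continuity), CLOSURE form, for the side `(D, k, l)`: every
generator `ϑ_{T,χ}(Φ)` (`χ` allowed) lies in the closed span of the wedge-functions.  For `(T.t34 V c, 2, 3)` this is
the body of model input A8 / the `real34` field of `Universe.ThetaRealisation` (closure form, DIVERGENCE.md E2). -/
def N19_genIn : Prop :=
  ∀ χ : D.X, D.allowed χ → ∀ Φ : T.SK V c,
    D.ϑ χ Φ ∈ (Submodule.span ℂ (T.wedgeSet V c k l)).topologicalClosure

/-- **NODE N19 = PerL v5 Lemma 3.5 (i), verbatim shape** (tex ll. 350–353): "`S_{12}` is the closure of the span of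
the wedges `u_1\wedge u_2` (viewed as scalar functions) …; similarly for `S_{34}`" — for the side `(D, k, l)`. -/
def N19_statement : Prop :=
  D.S12 = (Submodule.span ℂ (T.wedgeSet V c k l)).topologicalClosure

/-- `S` is closed (it is a topological closure, `S12_def`, ll. 348–349). -/
theorem isClosed_S12 : IsClosed (D.S12 : Set (T.HG L ι₁ V)) := by
  rw [D.S12_def]
  exact Submodule.isClosed_topologicalClosure _

/-- Every generator `ϑ_{T,χ}(Φ)`, `χ` allowed, lies in `S` (definition of `S`, ll. 348–349). -/
theorem ϑ_mem_S12 (χ : D.X) (hχ : D.allowed χ) (Φ : T.SK V c) : D.ϑ χ Φ ∈ D.S12 := by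
  rw [D.S12_def]
  exact Submodule.le_topologicalClosure _ (Submodule.subset_span ⟨χ, hχ, Φ, rfl⟩)

/-- A wedge-function of theta one-forms lies in the closed span of all of them. -/
theorem Λ_mem_wedgeClosure (Γ : Level V) {ω ω' : U.CohC (U.pms L ι₁ V Γ) 1} (hω : ω ∈ T.Theta V c k Γ)
    (hω' : ω' ∈ T.Theta V c l Γ) :
    T.Λ Γ ω ω' ∈ (Submodule.span ℂ (T.wedgeSet V c k l)).topologicalClosure :=
  Submodule.le_topologicalClosure _ (Submodule.subset_span ⟨Γ, ω, hω, ω', hω', rfl⟩)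

/-- **Lemma 3.5 (i) ⟺ (wedge ⊆) ∧ (gen ⊆)** — the package's two separately posited inclusions are together exactly
PerL's lemma for the side.  (→): both inclusions are read off the equality.  (←): `S ⊆` closed wedge span because
`S` is the SMALLEST closed submodule containing the generators (`S12_def` + `topologicalClosure_minimal`) and the
generators lie in the closed wedge span; `⊇` because `S` is closed and contains every wedge. -/
theorem N19_iff : N19_statement T V c D k l ↔ N19_wedgeIn T V c D k l ∧ N19_genIn T V c D k l := by
  constructor
  · intro h
    refine ⟨fun Γ ω ω' hω hω' => ?_, fun χ hχ Φ => ?_⟩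
    · rw [show D.S12 = _ from h]
      exact Λ_mem_wedgeClosure T V c k l Γ hω hω'
    · rw [← show D.S12 = _ from h]
      exact ϑ_mem_S12 T V c D χ hχ Φ
  · rintro ⟨hw, hg⟩
    apply le_antisymm
    · rw [D.S12_def]
      refine Submodule.topologicalClosure_minimal _ (Submodule.span_le.mpr ?_)
        (Submodule.isClosed_topologicalClosure _)
      rintro u ⟨χ, hχ, Φ, rfl⟩
      exact hg χ hχ Φ
    · refine Submodule.topologicalClosure_minimal _ (Submodule.span_le.mpr ?_) (isClosed_S12 T V c D)
      rintro x ⟨Γ, ω, hω, ω', hω', rfl⟩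
      exact hw Γ ω ω' hω hω'

/-! ### (wedge ⊆ S): split into the seesaw-generator identity and allowedness -/

/-- **Residual INPUT of the (wedge ⊆) direction = the seesaw-generator identity** (PerL v5 ll. 372–375:
"`u_1\wedge u_2=\vartheta_{T,\chi_{12}}(\Phi')=\mathrm{pr}_\kappa\vartheta_{T,\chi_{12}}(\Phi')=\vartheta_{T,\chi_{12}}
(\mathrm{pr}_\kappa\Phi')` for `\Phi'=\phi^1_1\otimes\phi^2_2-\phi^2_1\otimes\phi^1_2`, since `u_1\wedge u_2` is of pure
type `\kappa` and `\mathrm{pr}_\kappa` commutes with `\vartheta_{T,\chi_{12}}`"; print heart = Lemma 3.4 (eq:seesaw),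
node N17: Kudla's splitting compatibility [Kudla 1994 §1], [HKS §§1–3]).  Typed with the character `χ ∈ X` of the
pair and the test vector `Φ' ∈ 𝒮^κ` existential (rendering note R-b of node N33d).  NOT provable in the package (no
Weil-representation vocabulary, LEMMAS.md §3 D4); see HOME/GAPS.md entry pv08/N19. -/
def N19w_genIdentity : Prop :=
  ∀ (Γ : Level V), ∀ ω ∈ T.Theta V c k Γ, ∀ ω' ∈ T.Theta V c l Γ,
    ∃ χ : D.X, ∃ Φ : T.SK V c, T.Λ Γ ω ω' = D.ϑ χ Φ

/-- The same identity with the character recorded as ALLOWED (the shape in which Lemma 3.5 itself needs no input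
from Lemma 4.2(b): its wedges are, by hypothesis, attached to allowed pairs). -/
def N19w_genIdentityAllowed : Prop :=
  ∀ (Γ : Level V), ∀ ω ∈ T.Theta V c k Γ, ∀ ω' ∈ T.Theta V c l Γ,
    ∃ χ : D.X, D.allowed χ ∧ ∃ Φ : T.SK V c, T.Λ Γ ω ω' = D.ϑ χ Φ

/-- **INPUT = node N31's output for the side** (Lemma 4.2(b), ll. 529–534; used at Prop 4.3 ll. 660–662): every
character of the torus of the side's archimedean type arises from an allowed pair (the body of
`IsolationSetting.H_chars12` / `H_chars34`). -/
def N19_charsIn : Prop :=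
  ∀ χ : D.X, D.allowed χ

/-- (Ported verbatim from the HodgeCMPerL package; no docstring in the source.) -/
theorem N19w_genIdentityAllowed_of (hgen : N19w_genIdentity T V c D k l) (hch : N19_charsIn T V c D) :
    N19w_genIdentityAllowed T V c D k l := fun Γ ω hω ω' hω' =>
  let ⟨χ, Φ, h⟩ := hgen Γ ω hω ω' hω'
  ⟨χ, hch χ, Φ, h⟩

/-- **(wedge ⊆ S) PROVED from the allowed seesaw-generator identity**: the wedge IS a generator. -/
theorem N19w_of_allowedIdentity (hgen : N19w_genIdentityAllowed T V c D k l) : N19_wedgeIn T V c D k l := by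
  intro Γ ω ω' hω hω'
  obtain ⟨χ, hχ, Φ, h⟩ := hgen Γ ω hω ω' hω'
  rw [h]
  exact ϑ_mem_S12 T V c D χ hχ Φ

/-- **(wedge ⊆ S) PROVED from the seesaw-generator identity (node N17 residue) + allowedness (node N31).** -/
theorem N19w_of (hgen : N19w_genIdentity T V c D k l) (hch : N19_charsIn T V c D) : N19_wedgeIn T V c D k l :=
  N19w_of_allowedIdentity T V c D k l (N19w_genIdentityAllowed_of T V c D k l hgen hch)

/-! ### (gen ⊆ closed wedge span): split into the finite-sum core on a dense subspace and density/continuity -/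

/-- **Residual INPUT of the (gen ⊆) direction = the finite-sum core on a dense subspace** (PerL v5 ll. 356–372:
"Let `\mathcal P\subset\cS` be the subspace of functions which are Fock polynomials (times the Gaussian) at the
archimedean places; it is dense in `\cS` … and `\mathrm{pr}_\kappa(\mathcal P)` is dense in `\cS^\kappa`. … [for]
`\Phi\in\mathrm{pr}_\kappa(\mathcal P)` … every `K`-finite generator of `S_{12}` is a linear combination of wedges
`u_1\wedge u_2` of such forms" — seesaw (eq:seesaw) on pure tensors + the `K_{ι₁}`-type count in the Fock model of
`J⁺` ([Y1neg] Lemma 3.1 ← Kashiwara–Vergne 1978 / Adams 2007) + `U(1)`-weight of `κ`).  Typed with the dense subspace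
`P = pr_κ(𝒫)` EXISTENTIAL (rendering note R-b).  NOT provable in the package (no Fock-model vocabulary, LEMMAS.md
§3 D4/D5); see HOME/GAPS.md entry pv08/N19. -/
def N19g_core : Prop :=
  ∃ P : Set (T.SK V c), Dense P ∧
    ∀ χ : D.X, D.allowed χ → ∀ Φ ∈ P, D.ϑ χ Φ ∈ Submodule.span ℂ (T.wedgeSet V c k l)

/-- `Φ ↦ ϑ_{T,χ}(Φ)` is continuous into `L²([G_U])` — from the interface's own field AX5b (node N18, ll. 343–347:
"a continuous function of `\Phi`", into `C([G_U])`) and the bounded inclusion `C([G_U]) ⊂ L²` (`inclCG`). -/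
theorem continuous_ϑ (χ : D.X) : Continuous fun Φ : T.SK V c => D.ϑ χ Φ :=
  (T.core V c).inclCG.continuous.comp (D.AX5b_ϑ_cont χ)

/-- **(gen ⊆ closed wedge span) PROVED from the finite-sum core** — PerL l. 358–359 "By continuity of
`\vartheta_{T,\chi_{12}}` it suffices to treat `\Phi\in\mathrm{pr}_\kappa(\mathcal P)`": a continuous map takes the
closure of `P` (all of `𝒮^κ`) into the closure of the image of `P`, which lies in the closed wedge span. -/
theorem N19g_of (hcore : N19g_core T V c D k l) : N19_genIn T V c D k l := by
  obtain ⟨P, hP, hspan⟩ := hcore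
  intro χ hχ Φ
  have hΦ : Φ ∈ closure P := by rw [hP.closure_eq]; exact Set.mem_univ Φ
  have h1 : D.ϑ χ Φ ∈ closure ((fun Ψ : T.SK V c => D.ϑ χ Ψ) '' P) :=
    image_closure_subset_closure_image (continuous_ϑ T V c D χ) ⟨Φ, hΦ, rfl⟩
  rw [← SetLike.mem_coe, Submodule.topologicalClosure_coe]
  refine closure_mono ?_ h1
  rintro _ ⟨Ψ, hΨ, rfl⟩
  exact hspan χ hχ Ψ hΨ

/-! ### The node from its residual cores -/

/-- **N19 for a side, PROVED from the two print-heart residues + allowedness**: Lemma 3.5 (i) ⇐ seesaw-generator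
identity (N17 residue) + Lemma 4.2(b) output (N31) + finite-sum core on a dense subspace (Fock-model residue). -/
theorem N19_of_cores (hgen : N19w_genIdentity T V c D k l) (hch : N19_charsIn T V c D)
    (hcore : N19g_core T V c D k l) : N19_statement T V c D k l :=
  (N19_iff T V c D k l).mpr ⟨N19w_of T V c D k l hgen hch, N19g_of T V c D k l hcore⟩

/-- The (12) side: `N19_statement T V c (T.t12 V c) 0 1`; the (34) side ("similarly for `S_{34}`"):
`N19_statement T V c (T.t34 V c) 2 3`.  What the realisation record consumes is one inclusion per side: -/
theorem N19_consumed (h12 : N19_statement T V c (T.t12 V c) 0 1) (h34 : N19_statement T V c (T.t34 V c) 2 3) :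
    N19_wedgeIn T V c (T.t12 V c) 0 1 ∧ N19_genIn T V c (T.t34 V c) 2 3 :=
  ⟨((N19_iff T V c _ 0 1).mp h12).1, ((N19_iff T V c _ 2 3).mp h34).2⟩

end PerL34
end HodgeCM
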